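import Summits.HubbardSuperconductivity.HubbardSuperconductivity.Theorems.AnisotropyChordTransferFibre3FinXDCheck
import Summits.HubbardSuperconductivity.HubbardSuperconductivity.Theorems.AnisotropyChordTransferFibre3FinXDSideZ
import Summits.HubbardSuperconductivity.HubbardSuperconductivity.Theorems.AnisotropyChordTransferFibre3FinXBSym

/-!
# Route `AnisotropyChord` / H0 rotor rung: FIN per-`L` row-D / side-condition cells — XB-sym variants (mid `L`)

The row-D cell certificate `xdCellOK` and the side-condition certificate `sdOKz` take their scalars and objects from g5's `xbEval`, whose
in-kernel two-propagator table exceeds the per-declaration budget from `L ≈ 17`.  Here are the same programs on g5's XB-sym objects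
`xbEvalW` (wedge-only `T`-table, `…FinXBSym`): `xdCellW`, `xdCellOKW`, `xdCellAnyTW`, `xdCellAnyW0`, `sdDataW`, `sdOKzW`, `sdCellAnyZW`, and
the PROGRAM EQUIVALENCES `xdCellOKW_eq`, `xdCellAnyTW_eq`, `xdCellAnyW0_eq`, `sdOKzW_eq`, `sdCellAnyZW_eq` (from `xbEvalW_eq`) — so a kernel
fact decided on the W-program rewrites to the fact the soundness theorems consume (`rw [← xdCellAnyW0_eq]; decide +kernel`).
Prover seat `hubbard-h0-rotor-p3` g7; helper for piece A = stmt-HubbardSuperconductivity-23918 of rung 19089 (`--supports`, helper class).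
WHAT THIS IS NOT: nothing here proves superconductivity in the Hubbard model (rotor TARGET as worded stays FALSE, g15 verdict); evaluator
infrastructure for the FIN certificates of ONE conditional reduction.  Tree imports only; no sorry, no new axioms.
-/

set_option linter.dupNamespace false
set_option autoImplicit false

namespace Summit.HubbardSuperconductivity.HubbardSuperconductivity.Theorems.AnisotropyChord.Transfer.Fibre3

namespace FinXD

open Hole2 FinCell FinXB

/-- XB-sym variant of `xdCell` (objects from `xbEvalW`): (lower ends at `la`, upper ends at `lb`; `W(q)` = point value at `la` widened by
the variation `T⁺(q) − T⁻(q)` of the two-propagator sum over the cell; `G̃(x̂)` = point value at `la` plus `[0, h]·`slope enclosure). -/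
def xdCellW (L : ℕ) (la lb : ℤ) (ptLo ptHi : XDPt) : XDCell :=
  let V : ℕ := L * L
  let ct := cosTab L
  let gt := gresCellTab L ct la lb
  let E := xbEvalW L la lb
  let S := E.1
  let O := E.2
  let cT : List Iv := (List.range keysQ.length).map fun i => ((getIv ptLo.tT i).1, (getIv ptHi.tT i).2)
  { L := L, lam := (la, lb), a := S.a, cs := S.cs, fnn := iadd S.a (idivn (iscale V (la, lb)) 4),
    A := iadd (iconst (V : ℤ)) S.a,
    S1 := iscale V (G0Iv L la lb),
    gx := iadd (GresCellIv L la la 1 0) (imul (0, lb - la) (GresSlopeIv L la lb 1 0)),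
    eps1 := S.eps1,
    nt := imul O.Q (iinv O.P),
    gt := gt,
    cT := cT,
    cG3 := (List.range keys3.length).map fun i => ((getIv ptLo.tG3 i).1, (getIv ptHi.tG3 i).2),
    cW := (List.range keysQ.length).map fun i =>
      cwiden (ptLo.tW.getD i ((0, 0), (0, 0))) ((getIv cT i).2 - (getIv cT i).1),
    ct := ct, ct4 := cosTab (4 * L) }


/-- XB-sym variant of `xdCellOK`:
g4's ground-cell check, `1 − Δ > 0`, positive point denominators at `la`, nonnegative point tables of `g` at both ends, `P⁻ > 0`, every `den⁻ > 0`, `0 ≤ aD`,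
`T⁺⁻ = 3λ⁻ + (Q/P)⁻ ≥ 0`, and `D·Σ|R̂′|²⁺/den⁻ ≤ aD · V² · (V λ⁻/4) · 3V² T⁺⁻ · D` (i.e. `lowG ≤ aD η_eff U`). -/
def xdCellOKW (L : ℕ) (la lb : ℤ) (aD : ℚ) (ptLo ptHi : XDPt) : Bool :=
  let E := xbEvalW L la lb
  let C := xdCellW L la lb ptLo ptHi
  let s := C.lowGSum
  let V : ℚ := (((L : ℤ) * L : ℤ) : ℚ)
  let tlo : ℚ := ((3 * la + C.nt.1 : ℤ) : ℚ) / ((D : ℤ) : ℚ)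
  let etalo : ℚ := V * (la : ℚ) / (4 * ((D : ℤ) : ℚ))
  groundCellCheck L la lb && xbScalOK L la lb && denCellPos L (cosTab L) la la && gPtNonneg L la && gPtNonneg L lb &&
    decide (0 < E.2.P.1) && s.2 && decide (0 ≤ aD) && decide (0 ≤ tlo) &&
    decide (s.1 ≤ aD * V ^ 2 * etalo * (3 * V ^ 2 * tlo) * ((D : ℤ) : ℚ))


/-- XB-sym variant of `xdCellAnyT`: numerator-vacuous, `Δ`-vacuous on either side of `(0, Δ₁]`, or certified. -/
def xdCellAnyTW (L : ℕ) (d1 : ℚ) (la lb : ℤ) (aD : ℚ) (ptLo ptHi : XDPt) : Bool :=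
  (denCellPos L (cosTab L) la lb && decide ((numIv L la lb).2 < 0) && decide (0 ≤ (G0Iv L la lb).1)) ||
  (groundCellCheck L la lb &&
    (decide ((deltaIv L la lb).2 < 0) || decide (d1 * (D : ℚ) < (((deltaIv L la lb).1 : ℤ) : ℚ)))) ||
  xdCellOKW L la lb aD ptLo ptHi


/-- XB-sym variant of `xdCellAny0` (point tables recomputed). -/
def xdCellAnyW0 (L : ℕ) (d1 : ℚ) (la lb : ℤ) (aD : ℚ) : Bool := xdCellAnyTW L d1 la lb aD (xdPoint L la) (xdPoint L lb)

/-- XB-sym variant of `sdData`. -/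
def sdDataW (L : ℕ) (la lb : ℤ) (bn bd : ℕ) (aD : ℚ) : SDData :=
  let E := xbEvalW L la lb
  let S := E.1
  let O := E.2
  let V : ℕ := L * L
  let tplus := iadd (iscale 3 (la, lb)) (imul O.Q (iinv O.P))
  let c2 : Iv := idivn (iconst (((V * V : ℕ) : ℤ) - 5 * (V : ℤ) + 6)) (((V * V : ℕ) : ℤ))
  let m := isub (idivn (imul S.eps1 c2) 2) tplus
  let gap := isub (iscale 2 S.eps1) tplus
  let kap := imul (iscale 3 S.eps1) (iinv gap)
  let g0n := iadd (iscale 3 (isub ione S.delta)) m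
  let g0d := iadd (iconst 3) m
  let g0 := imul g0n (iinv g0d)
  let fac := iadd ione (imul (imul kap S.delta) (iinv g0))
  let eta := idivn (iscale V (la, lb)) 4
  let rho := iadd (iconst 2) (getIv (cosTab L) 1)
  { tplus := tplus, m := m, gap := gap, g0n := g0n, g0d := g0d, g0 := g0, fac := fac, eta := eta, rho := rho,
    lhs := imul (imul fac eta) (iadd (qIv aD) (imul (qIv ((bn : ℚ) / bd)) (iinv rho))) }


/-- XB-sym variant of `sdOKz` (the side-condition certificate of the cell with constants `(c, bn/bd, aD)`: the regime `m ≥ 0` and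
`fac·η·(aD + b/ρ) < c`, with the positivity side conditions of every reciprocal (as `sdOK`, without the superfluous `0 ≤ Δ⁻` conjunct, so that the cell
adjacent to `Δ = 0` can pass). -/
def sdOKzW (L : ℕ) (la lb : ℤ) (c : ℚ) (bn bd : ℕ) (aD : ℚ) : Bool :=
  let E := xbEvalW L la lb
  let Sd := sdDataW L la lb bn bd aD
  groundCellCheck L la lb && xbScalOK L la lb && decide (0 < E.2.P.1) && decide (0 < bd) &&
    decide (0 ≤ Sd.m.1) && decide (0 < Sd.gap.1) && decide (0 < Sd.g0n.1) && decide (0 < Sd.g0d.1) &&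
    decide (0 < Sd.g0.1) && decide (0 < Sd.rho.1) && decide (((Sd.lhs.2 : ℤ) : ℚ) < c * (D : ℚ))


/-- XB-sym variant of `sdCellAnyZ` (one cell of the per-`L` side-condition check with constants `(c, bn, aD)`: numerator-vacuous, `Δ`-vacuous on either side of
`(0, Δ₁]`, or certified by `sdOK`. -/
def sdCellAnyZW (L : ℕ) (d1 : ℚ) (bd : ℕ) (la lb : ℤ) (t : ℚ × ℕ × ℚ) : Bool :=
  (denCellPos L (cosTab L) la lb && decide ((numIv L la lb).2 < 0) && decide (0 ≤ (G0Iv L la lb).1)) ||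
  (groundCellCheck L la lb &&
    (decide ((deltaIv L la lb).2 < 0) || decide (d1 * (D : ℚ) < (((deltaIv L la lb).1 : ℤ) : ℚ)))) ||
  sdOKzW L la lb t.1 t.2.1 bd t.2.2


/-! ## Program equivalences -/

/-- `xdCellW = xdCell`. [folklore] -/
theorem xdCellW_eq (L : ℕ) (la lb : ℤ) (ptLo ptHi : XDPt) : xdCellW L la lb ptLo ptHi = xdCell L la lb ptLo ptHi := by
  unfold xdCellW xdCell; rw [xbEvalW_eq]

/-- `xdCellOKW = xdCellOK`. [folklore] -/
theorem xdCellOKW_eq (L : ℕ) (la lb : ℤ) (aD : ℚ) (ptLo ptHi : XDPt) :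
    xdCellOKW L la lb aD ptLo ptHi = xdCellOK L la lb aD ptLo ptHi := by
  unfold xdCellOKW xdCellOK; rw [xdCellW_eq, xbEvalW_eq]

/-- `xdCellAnyTW = xdCellAnyT`. [folklore] -/
theorem xdCellAnyTW_eq (L : ℕ) (d1 : ℚ) (la lb : ℤ) (aD : ℚ) (ptLo ptHi : XDPt) :
    xdCellAnyTW L d1 la lb aD ptLo ptHi = xdCellAnyT L d1 la lb aD ptLo ptHi := by
  unfold xdCellAnyTW xdCellAnyT; rw [xdCellOKW_eq]

/-- `xdCellAnyW0 = xdCellAny0`. [folklore] -/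
theorem xdCellAnyW0_eq (L : ℕ) (d1 : ℚ) (la lb : ℤ) (aD : ℚ) : xdCellAnyW0 L d1 la lb aD = xdCellAny0 L d1 la lb aD := by
  unfold xdCellAnyW0 xdCellAny0; rw [xdCellAnyTW_eq]

/-- `sdDataW = sdData`. [folklore] -/
theorem sdDataW_eq (L : ℕ) (la lb : ℤ) (bn bd : ℕ) (aD : ℚ) : sdDataW L la lb bn bd aD = sdData L la lb bn bd aD := by
  unfold sdDataW sdData; rw [xbEvalW_eq]

/-- `sdOKzW = sdOKz`. [folklore] -/
theorem sdOKzW_eq (L : ℕ) (la lb : ℤ) (c : ℚ) (bn bd : ℕ) (aD : ℚ) : sdOKzW L la lb c bn bd aD = sdOKz L la lb c bn bd aD := by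
  unfold sdOKzW sdOKz; rw [sdDataW_eq, xbEvalW_eq]

/-- `sdCellAnyZW = sdCellAnyZ`. [folklore] -/
theorem sdCellAnyZW_eq (L : ℕ) (d1 : ℚ) (bd : ℕ) (la lb : ℤ) (t : ℚ × ℕ × ℚ) :
    sdCellAnyZW L d1 bd la lb t = sdCellAnyZ L d1 bd la lb t := by
  unfold sdCellAnyZW sdCellAnyZ; rw [sdOKzW_eq]

end FinXD

end Summit.HubbardSuperconductivity.HubbardSuperconductivity.Theorems.AnisotropyChord.Transfer.Fibre3
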